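import Summits.BirchSwinnertonDyer.Rank1Residual.X10.SelfTwistVisibleGoodAtThree
import HarnessLib

/-!
# N2 (X10b @ 3): SELF-TWIST visibility records with the place `3` FREE (kind (v), Mazur–Rubin 2015) —
# `55696n1` (twin `55696o1`, `d* = −59`) and `110224f1` (twin `110224g1`, `d* = −83`)
# (cell `b2b-bsdres`, unit `b2b-bsdres-x10` = N2 class lead, GEN 22; per-pair RECORDS, close nothing)

HONEST FRAMING (cell `b2b-bsdres`, run/shared/lean/b2b/bsd-rank1-residual/, verbatim in every
file): the goal of the cell is to DELETE the COMBINATION-SHAPED residual classes of the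
Birch–Swinnerton-Dyer formula for ALL analytic-rank `≤ 1` elliptic curves over `ℚ` — "full BSD
formula for every rank `≤ 1` curve in class `C`" assembled STRICTLY from published theorems — so
that the rank-`≤ 1` remainder becomes exactly the CONSTRUCTION-SHAPED classes, which are TYPED
(missing-input `Prop`s), NOT attempted. This is not "finishing BSD". Class X10b (= N2) stays
CONSTRUCTION-SHAPED (NEEDS `X_A3`); this file holds PER-PAIR RECORDS of the LOWER half only; nothing is
booked; no mark / label / tier / count is changed. Theorems only (no definition, no named fact of ours,
no `sorry`).

## What

Continuation of `X10/SelfTwistVisibleGoodAtThree.lean` (x10 GEN 22; socket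
`exists_sha_ne_zero_three_of_congr_goodAtThree[_mult]_of_primeList`): the N2 self-twist visibility road
(x10 GEN 21 `SELF-TWIST-LAW.md`, `class-closure/N2/KIND-VIII-SPEC-x10g21.md`) for the rank-`0` Ш-cells whose
rank-2 twin is ANOMALOUS at `3` (`#E′(ℚ₃)[3] = 3`, PAY3 = 9 = 3², no budget), with the place `3` FREE of
kind (v): Mazur–Rubin, *Selmer companion curves*, Trans. AMS 367 (2015) Thm. 3.1 (iv)(b) / §6 Case 5 — the
tree's NAMED FACT `selmerLocalKer_iff_of_goodReduction_above` (x10b GEN 15), binder `hMR` DISPLAYED.  Per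
record: `∃ c ∈ Ш(E), c ≠ 0, 3c = 0`; `3² ∣ #Ш(E)[3^∞]` (`hCT`); the typed LOWER binder
`MissingLowerBoundAt W 3` (`hq`).  Every local binder IN THE KERNEL: TamLocal certificates (n1011-p18's glue
`g11/tools/vis3_certs.py` UNCHANGED, observatory Tate engine), the twin's global minimality (x11c's Kraus
criterion / x10 GEN 18's pattern F2d), `E[3]` irreducible from a Frobenius witness over x10 GEN 12's landed
point counts.  BINDERS LEFT (displayed, EVIDENCE columns — nothing booked): `hMR`, `hCT`, `hGZK`,
`hr : r_an(E) = 0` (Cremona), `θ : E′[3] ≃ E[3]` with `hθ` (the self-twist congruence `ρ̄ ⊗ χ_{d*} ≅ ρ̄` of the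
`3Ns` image; EVIDENCE: cc-eng-2 KO-certified `class-closure/N2/CONG-certified-eng2.tsv`, kit j123296, rows
quoted per record), `hrank : 1 ≤ rank E′(ℚ)` (Cremona: rank `2`, generators quoted), `hq` (`#Ш_an`).
Rows here: `55696n1` (`N = 2⁴·59²`; KO row 55696n certified against 55696l, bound 14 159, 1 665 primes —
`55696o = 55696n ⊗ χ_{−59}` is x10 GEN 21's census twin, all four curves `E[3]`-isomorphic; twin generators
`(98, 944)`, `(−20, 118)`; witness `ℓ = 13`, `#Ẽ = 11`) and `110224f1` (`N = 2⁴·83²`; KO row 110224f/110224g,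
bound 27 887, 3 041 primes; twin generators `(−28, 166)`, `(−34, 128)`; witness `ℓ = 13`, `#Ẽ = 8`, numeral
`noroot3_frob_13_8` of the first file).  Twins additive at `2` (`I*ₙ`, value set `{2,4}`) and at `59` / `83`
(type `III`, `c = 2`).

References: [MazurRubin2015SelmerCompanions] Thm. 3.1 (iv)(b), §5.3, §6 Case 5; [CremonaMazur2000] §3;
[AgasheStein2002] Thm. 3.1; [Mazur1978] Prop. 6.3 (1); [SilvermanATAEC1994] IV.9.4, V.5.3–5.4;
[SilvermanAEC2009] VII.5.1, X.4.14; [Kraus1989] Prop. 2; [Cremona2006] Table 1.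
-/

set_option autoImplicit false

noncomputable section

open scoped Classical NumberField
open IsDedekindDomain NumberField WeierstrassCurve Rat.HeightOneSpectrum
  Literature.NumberTheory.EllipticCurves Literature.NumberTheory.EllipticCurves.ModularForms
  Literature.NumberTheory.EllipticCurves.Rank1Residual
  Literature.NumberTheory.EllipticCurves.Rank1Residual.Typed
  Literature.NumberTheory.EllipticCurves.MazurRubin2015
  Literature.NumberTheory.GaloisRepresentations
  Summit.BirchSwinnertonDyer.BirchSwinnertonDyer.Rank1Residual.IntModel
  Summit.BirchSwinnertonDyer.BirchSwinnertonDyer.Rank1Residual.X11RankOne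
  Summit.BirchSwinnertonDyer.BirchSwinnertonDyer.Rank2Observatory
  Summit.BirchSwinnertonDyer.BirchSwinnertonDyer.Rank2Observatory.Tam
  Summit.BirchSwinnertonDyer.Rank1Residual.GaloisImage
  Summit.BirchSwinnertonDyer.Rank1Residual.GaloisImage.LocalTorsion3At
  Summit.BirchSwinnertonDyer.Rank1Residual.Additive
  Summit.BirchSwinnertonDyer.Rank1Residual.X11b

namespace Summit.BirchSwinnertonDyer.Rank1Residual.X10.SelfTwist

/-! ### Record `55696n1` (twin `55696o1`; `N = 55696 = 2⁴·59²`, `d* = -59`, `#Ш_an(E) = 9`) -/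
/-- The Frobenius polynomial at `13` of a curve with `#Ẽ(𝔽_{13}) = 11` reduced mod `3`, `X² − (13 + 1 − 11)X + 13`, has no
root in `𝔽₃` (irreducibility witness numeral, x10 GEN 12's shape). [folklore] -/
theorem noroot3_frob_13_11 :
    ∀ t : ZMod 3, t ^ 2 - ((((13 : ℕ) : ℤ) + 1 - (11 : ℕ) : ℤ) : ZMod 3) * t + ((13 : ℕ) : ZMod 3) ≠ 0 := by
  decide

/-- The local Tamagawa certificate of the self-twist `55696o1` at `2` (`TamLocal` = `⟨2, 1, 5, 0, 2, 1, 16, 15, 71, 3, 4⟩`, additive Kodaira `I*ₙ`, value set `{2,4}`) passes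
the kernel check (n1011-p18's glue `vis3_certs.py`, observatory Tate engine, unchanged). [cite: SilvermanATAEC1994, IV.9.4] -/
theorem tamLocal_check_55696o1_2 :
    TamLocal.check ⟨2, 1, 5, 0, 2, 1, 16, 15, 71, 3, 4⟩ ⟨0, 1, 0, (-688), 7764⟩ = true := by
  decide +kernel

/-- The local Tamagawa certificate of the self-twist `55696o1` at `59` (`TamLocal` = `⟨59, 7, 4, 0, 39, 0, 0, 3, 3, 2, 2⟩`, additive type `III`, `c = 2`) passes
the kernel check (n1011-p18's glue `vis3_certs.py`, observatory Tate engine, unchanged). [cite: SilvermanATAEC1994, IV.9.4] -/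
theorem tamLocal_check_55696o1_59 :
    TamLocal.check ⟨59, 7, 4, 0, 39, 0, 0, 3, 3, 2, 2⟩ ⟨0, 1, 0, (-688), 7764⟩ = true := by
  decide +kernel

/-- **SELF-TWIST VISIBILITY RECORD, place `3` FREE (closes nothing, moves no mark): a non-zero `3`-torsion
element of `Ш(E/ℚ)` for `E = 55696n1` from its rank-2 self-twist `E′ = 55696o1 = E ⊗ χ_{-59}`**, both curves
GOOD ORDINARY and ANOMALOUS at `3` (kind (v), `hMR`); the other places of `S` = places over `[2, 3, 59]` are additive for
`E′` with `E′(ℚ_ℓ)[3] = 0` (kind (i), TamLocal certificates in the kernel: `2` (Kodaira I*ₙ, value set {2,4}), `59` (type III, c = 2)); `E[3]` irreducible from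
the Frobenius witness `ℓ = 13` (`#Ẽ(𝔽_{13}) = 11`). Conditional on `hMR` (Mazur–Rubin 2015).
[cite: MazurRubin2015SelmerCompanions, Thm. 3.1 (iv)(b) and §6 proof Case 5] [cite: CremonaMazur2000, §3 and Table 1]
[cite: Mazur1978, §6 Prop. 6.3 (1) (p. 153)] [cite: Cremona2006, Table 1 (labels 55696n1, 55696o1)] -/
theorem exists_sha_three_selfTwist_v55696n1
    (hMR : selmerLocalKer_iff_of_goodReduction_above)
    (hGZK : rank_eq_analyticRank_of_analyticRank_le_one)
    (W : WeierstrassCurve ℚ) [W.IsElliptic] [W.IsGloballyMinimal]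
    (hI : integralModelInt W = ⟨0, 1, 0, (-2396088), (-1642476716)⟩) (hr : W.analyticRank = 0)
    (W' : WeierstrassCurve ℚ) (hW' : W' = ⟨0, 1, 0, (-688), 7764⟩) [W'.IsElliptic]
    (θ : geomTorsion W' ((3 : ℕ) : ℤ) ≃+ geomTorsion W ((3 : ℕ) : ℤ))
    (hθ : ∀ (σ : Field.absoluteGaloisGroup ℚ) (P : geomTorsion W' ((3 : ℕ) : ℤ)), θ (σ • P) = σ • θ P)
    (hrank : 1 ≤ W'.mordellWeilRank) :
    ∃ c : W.sha, c ≠ 0 ∧ 3 • c = 0 := by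
  haveI : Fact (Nat.Prime 3) := ⟨Nat.prime_three⟩
  haveI : Fact (Nat.Prime 2) := ⟨by norm_num⟩
  haveI : Fact (Nat.Prime 13) := ⟨by norm_num⟩
  haveI : Fact (Nat.Prime 59) := ⟨by norm_num⟩
  -- the row `55696n1`: `E(ℚ)` finite of order prime to `3`
  have hfin : Finite W.toAffine.Point := finite_point_of_analyticRank_eq_zero W hGZK hr
  have hirr : W.HasIrreducibleModPGaloisRep 3 :=
    hasIrreducibleModPGaloisRep_of_intModel_of_noroot hI 3 13 (by norm_num) (by decide +kernel)
      Summit.BirchSwinnertonDyer.Rank1Residual.X10.card_t55696n1_13 noroot3_frob_13_11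
  have hcop : (Nat.card W.toAffine.Point).Coprime 3 := coprime_natCard_point_of_irr W 3 hirr
  have hE : (⟨0, 1, 0, (-2396088), (-1642476716)⟩ : WeierstrassCurve ℤ).map (Int.castRingHom ℚ) = W := by
    rw [IntModelTam.eq_baseChange_of_integralModelInt hI]; rfl
  -- the partner `55696o1`: globally minimal, integral model
  have hM' : W'.IsGloballyMinimal := by
    rw [hW']
    exact Summit.BirchSwinnertonDyer.Rank1Residual.X10.isGloballyMinimal_of_krausCriterion_bounded₃ 0 1 0 (-688) 7764
      (by decide +kernel) (by decide +kernel) (by decide +kernel) (by decide +kernel)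
  have hI' : integralModelInt W' = ⟨0, 1, 0, (-688), 7764⟩ := by
    subst hW'; exact integralModelInt_eq_of_map_eq _ (map_mk_int 0 1 0 (-688) 7764)
  have hF : (⟨0, 1, 0, (-688), 7764⟩ : WeierstrassCurve ℤ).map (Int.castRingHom ℚ) = W' := by
    rw [hW']; exact map_mk_int 0 1 0 (-688) 7764
  -- prime support of the two discriminants
  have hΔE : ∀ q : ℕ, q.Prime → (q : ℤ) ∣ (⟨0, 1, 0, (-2396088), (-1642476716)⟩ : WeierstrassCurve ℤ).Δ → q ∈ [2, 3, 59] :=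
    X11b.forall_mem_of_natAbs_eq_prod_pow [2, 3, 59] [15, 0, 9]
      (by intro q hq; simp only [List.mem_cons, List.mem_nil_iff, or_false] at hq; rcases hq with rfl | rfl | rfl <;> norm_num)
      (by decide +kernel)
  have hΔF : ∀ q : ℕ, q.Prime → (q : ℤ) ∣ (⟨0, 1, 0, (-688), 7764⟩ : WeierstrassCurve ℤ).Δ → q ∈ [2, 3, 59] :=
    X11b.forall_mem_of_natAbs_eq_prod_pow [2, 3, 59] [15, 0, 3]
      (by intro q hq; simp only [List.mem_cons, List.mem_nil_iff, or_false] at hq; rcases hq with rfl | rfl | rfl <;> norm_num)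
      (by decide +kernel)
  refine exists_sha_ne_zero_three_of_congr_goodAtThree_of_primeList hMR W W' θ hθ hE hF [2, 3, 59] (by simp) hΔE hΔF
    (by decide +kernel) (by decide +kernel) hfin hcop hrank (fun v hvL hv3 ↦ ?_)
  simp only [List.mem_cons, List.mem_nil_iff, or_false] at hvL
  rcases hvL with h2 | h3 | h59
  · -- `v = 2`: additive Kodaira I*ₙ, value set {2,4}
    exact LocalTorsionAway.natCard_ker_nsmul_adicCompletion_eq_one_of_intModel_of_additive_tamLocal_forall hI' 2 3
      (by norm_num) h2 (by decide) (by decide) (E := ⟨2, 1, 5, 0, 2, 1, 16, 15, 71, 3, 4⟩) rfl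
      tamLocal_check_55696o1_2 (by decide)
  · exact absurd h3 hv3
  · -- `v = 59`: additive type III, `c = 2`
    exact LocalTorsionAway.natCard_ker_nsmul_adicCompletion_eq_one_of_intModel_of_additive hI' 59 3 (by norm_num) h59
      (by decide) (by decide)
      (IntModelTam.localTamagawaNumber_padic_eq_of_intModel_of_tamLocal hI' 59 (E := ⟨59, 7, 4, 0, 39, 0, 0, 3, 3, 2, 2⟩)
        rfl tamLocal_check_55696o1_59 (c := 2) (by decide)) (by norm_num)

/-- **`3² ∣ #Ш(55696n1)[3^∞]`** from the visible element and the Cassels–Tate parity (`hCT`). Conditional on `hMR`, `hCT`.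
[cite: SilvermanAEC2009, Thm. X.4.14] [cite: MazurRubin2015SelmerCompanions, Thm. 3.1 (iv)(b)] -/
theorem sq_dvd_card_sha_three_selfTwist_v55696n1
    (hCT : exists_casselsTate_pairing (K := ℚ))
    (hMR : selmerLocalKer_iff_of_goodReduction_above)
    (hGZK : rank_eq_analyticRank_of_analyticRank_le_one)
    (W : WeierstrassCurve ℚ) [W.IsElliptic] [W.IsGloballyMinimal]
    (hI : integralModelInt W = ⟨0, 1, 0, (-2396088), (-1642476716)⟩) (hr : W.analyticRank = 0)
    (W' : WeierstrassCurve ℚ) (hW' : W' = ⟨0, 1, 0, (-688), 7764⟩) [W'.IsElliptic]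
    (θ : geomTorsion W' ((3 : ℕ) : ℤ) ≃+ geomTorsion W ((3 : ℕ) : ℤ))
    (hθ : ∀ (σ : Field.absoluteGaloisGroup ℚ) (P : geomTorsion W' ((3 : ℕ) : ℤ)), θ (σ • P) = σ • θ P)
    (hrank : 1 ≤ W'.mordellWeilRank) :
    3 ^ 2 ∣ Nat.card (AddCommGroup.primaryComponent W.sha 3) := by
  haveI : Finite W.sha := (hGZK W (by rw [hr]; exact zero_le_one)).2
  exact Visible.sq_dvd_card_sha_three_of_exists_sha_torsion hCT W
    (exists_sha_three_selfTwist_v55696n1 hMR hGZK W hI hr W' hW' θ hθ hrank)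

/-- **The typed LOWER binder `MissingLowerBoundAt E 3` for `55696n1`** (`ord₃ #Ш_an ≤ ord₃ #Ш`) from the visible
`3`-torsion element, the Cassels–Tate squareness and the analytic datum `#Ш_an = 9` (`hq`, Cremona `allbsd`;
evidence binder). Conditional on `hMR`, `hCT`. [cite: SilvermanAEC2009, Thm. X.4.14] [cite: Cremona2006, Table 1 (label 55696n1)] -/
theorem missingLowerBoundAt_three_selfTwist_v55696n1
    (hCT : exists_casselsTate_pairing (K := ℚ))
    (hMR : selmerLocalKer_iff_of_goodReduction_above)
    (hGZK : rank_eq_analyticRank_of_analyticRank_le_one)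
    (W : WeierstrassCurve ℚ) [W.IsElliptic] [W.IsGloballyMinimal]
    (hI : integralModelInt W = ⟨0, 1, 0, (-2396088), (-1642476716)⟩) (hr : W.analyticRank = 0)
    {q : ℚ} (hq : shaAn W = (q : ℂ)) (hv : padicValRat 3 q ≤ 2)
    (W' : WeierstrassCurve ℚ) (hW' : W' = ⟨0, 1, 0, (-688), 7764⟩) [W'.IsElliptic]
    (θ : geomTorsion W' ((3 : ℕ) : ℤ) ≃+ geomTorsion W ((3 : ℕ) : ℤ))
    (hθ : ∀ (σ : Field.absoluteGaloisGroup ℚ) (P : geomTorsion W' ((3 : ℕ) : ℤ)), θ (σ • P) = σ • θ P)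
    (hrank : 1 ≤ W'.mordellWeilRank) :
    haveI : Fact (Nat.Prime 3) := ⟨Nat.prime_three⟩
    MissingLowerBoundAt W 3 := by
  haveI : Fact (Nat.Prime 3) := ⟨Nat.prime_three⟩
  have hvis := exists_sha_three_selfTwist_v55696n1 hMR hGZK W hI hr W' hW' θ hθ hrank
  exact missingLowerBoundAt_of_casselsTate_of_pow_dvd W 3 hCT (hGZK W (by rw [hr]; exact zero_le_one)).2 hq
    (k := 1) (by simpa using hv) (by simpa using dvd_shaOrder_of_exists_torsion W 3 hvis)

/-! ### Record `110224f1` (twin `110224g1`; `N = 110224 = 2⁴·83²`, `d* = -83`, `#Ш_an(E) = 9`) -/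
/-- The local Tamagawa certificate of the self-twist `110224g1` at `2` (`TamLocal` = `⟨2, 1, 5, 0, 30, 1, 64, 18, 72, 4, 4⟩`, additive Kodaira `I*ₙ`, value set `{2,4}`) passes
the kernel check (n1011-p18's glue `vis3_certs.py`, observatory Tate engine, unchanged). [cite: SilvermanATAEC1994, IV.9.4] -/
theorem tamLocal_check_110224g1_2 :
    TamLocal.check ⟨2, 1, 5, 0, 30, 1, 64, 18, 72, 4, 4⟩ ⟨0, 1, 0, (-968), 21620⟩ = true := by
  decide +kernel

/-- The local Tamagawa certificate of the self-twist `110224g1` at `83` (`TamLocal` = `⟨83, 9, 4, 0, 55, 0, 0, 3, 3, 2, 2⟩`, additive type `III`, `c = 2`) passes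
the kernel check (n1011-p18's glue `vis3_certs.py`, observatory Tate engine, unchanged). [cite: SilvermanATAEC1994, IV.9.4] -/
theorem tamLocal_check_110224g1_83 :
    TamLocal.check ⟨83, 9, 4, 0, 55, 0, 0, 3, 3, 2, 2⟩ ⟨0, 1, 0, (-968), 21620⟩ = true := by
  decide +kernel

/-- **SELF-TWIST VISIBILITY RECORD, place `3` FREE (closes nothing, moves no mark): a non-zero `3`-torsion
element of `Ш(E/ℚ)` for `E = 110224f1` from its rank-2 self-twist `E′ = 110224g1 = E ⊗ χ_{-83}`**, both curves
GOOD ORDINARY and ANOMALOUS at `3` (kind (v), `hMR`); the other places of `S` = places over `[2, 3, 83]` are additive for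
`E′` with `E′(ℚ_ℓ)[3] = 0` (kind (i), TamLocal certificates in the kernel: `2` (Kodaira I*ₙ, value set {2,4}), `83` (type III, c = 2)); `E[3]` irreducible from
the Frobenius witness `ℓ = 13` (`#Ẽ(𝔽_{13}) = 8`). Conditional on `hMR` (Mazur–Rubin 2015).
[cite: MazurRubin2015SelmerCompanions, Thm. 3.1 (iv)(b) and §6 proof Case 5] [cite: CremonaMazur2000, §3 and Table 1]
[cite: Mazur1978, §6 Prop. 6.3 (1) (p. 153)] [cite: Cremona2006, Table 1 (labels 110224f1, 110224g1)] -/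
theorem exists_sha_three_selfTwist_v110224f1
    (hMR : selmerLocalKer_iff_of_goodReduction_above)
    (hGZK : rank_eq_analyticRank_of_analyticRank_le_one)
    (W : WeierstrassCurve ℚ) [W.IsElliptic] [W.IsGloballyMinimal]
    (hI : integralModelInt W = ⟨0, 1, 0, (-6670848), (-12548797516)⟩) (hr : W.analyticRank = 0)
    (W' : WeierstrassCurve ℚ) (hW' : W' = ⟨0, 1, 0, (-968), 21620⟩) [W'.IsElliptic]
    (θ : geomTorsion W' ((3 : ℕ) : ℤ) ≃+ geomTorsion W ((3 : ℕ) : ℤ))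
    (hθ : ∀ (σ : Field.absoluteGaloisGroup ℚ) (P : geomTorsion W' ((3 : ℕ) : ℤ)), θ (σ • P) = σ • θ P)
    (hrank : 1 ≤ W'.mordellWeilRank) :
    ∃ c : W.sha, c ≠ 0 ∧ 3 • c = 0 := by
  haveI : Fact (Nat.Prime 3) := ⟨Nat.prime_three⟩
  haveI : Fact (Nat.Prime 2) := ⟨by norm_num⟩
  haveI : Fact (Nat.Prime 13) := ⟨by norm_num⟩
  haveI : Fact (Nat.Prime 83) := ⟨by norm_num⟩
  -- the row `110224f1`: `E(ℚ)` finite of order prime to `3`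
  have hfin : Finite W.toAffine.Point := finite_point_of_analyticRank_eq_zero W hGZK hr
  have hirr : W.HasIrreducibleModPGaloisRep 3 :=
    hasIrreducibleModPGaloisRep_of_intModel_of_noroot hI 3 13 (by norm_num) (by decide +kernel)
      Summit.BirchSwinnertonDyer.Rank1Residual.X10.card_t110224f1_13 noroot3_frob_13_8
  have hcop : (Nat.card W.toAffine.Point).Coprime 3 := coprime_natCard_point_of_irr W 3 hirr
  have hE : (⟨0, 1, 0, (-6670848), (-12548797516)⟩ : WeierstrassCurve ℤ).map (Int.castRingHom ℚ) = W := by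
    rw [IntModelTam.eq_baseChange_of_integralModelInt hI]; rfl
  -- the partner `110224g1`: globally minimal, integral model
  have hM' : W'.IsGloballyMinimal := by
    rw [hW']
    exact Summit.BirchSwinnertonDyer.Rank1Residual.X10.isGloballyMinimal_of_krausCriterion_bounded₃ 0 1 0 (-968) 21620
      (by decide +kernel) (by decide +kernel) (by decide +kernel) (by decide +kernel)
  have hI' : integralModelInt W' = ⟨0, 1, 0, (-968), 21620⟩ := by
    subst hW'; exact integralModelInt_eq_of_map_eq _ (map_mk_int 0 1 0 (-968) 21620)
  have hF : (⟨0, 1, 0, (-968), 21620⟩ : WeierstrassCurve ℤ).map (Int.castRingHom ℚ) = W' := by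
    rw [hW']; exact map_mk_int 0 1 0 (-968) 21620
  -- prime support of the two discriminants
  have hΔE : ∀ q : ℕ, q.Prime → (q : ℤ) ∣ (⟨0, 1, 0, (-6670848), (-12548797516)⟩ : WeierstrassCurve ℤ).Δ → q ∈ [2, 3, 83] :=
    X11b.forall_mem_of_natAbs_eq_prod_pow [2, 3, 83] [18, 0, 9]
      (by intro q hq; simp only [List.mem_cons, List.mem_nil_iff, or_false] at hq; rcases hq with rfl | rfl | rfl <;> norm_num)
      (by decide +kernel)
  have hΔF : ∀ q : ℕ, q.Prime → (q : ℤ) ∣ (⟨0, 1, 0, (-968), 21620⟩ : WeierstrassCurve ℤ).Δ → q ∈ [2, 3, 83] :=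
    X11b.forall_mem_of_natAbs_eq_prod_pow [2, 3, 83] [18, 0, 3]
      (by intro q hq; simp only [List.mem_cons, List.mem_nil_iff, or_false] at hq; rcases hq with rfl | rfl | rfl <;> norm_num)
      (by decide +kernel)
  refine exists_sha_ne_zero_three_of_congr_goodAtThree_of_primeList hMR W W' θ hθ hE hF [2, 3, 83] (by simp) hΔE hΔF
    (by decide +kernel) (by decide +kernel) hfin hcop hrank (fun v hvL hv3 ↦ ?_)
  simp only [List.mem_cons, List.mem_nil_iff, or_false] at hvL
  rcases hvL with h2 | h3 | h83
  · -- `v = 2`: additive Kodaira I*ₙ, value set {2,4}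
    exact LocalTorsionAway.natCard_ker_nsmul_adicCompletion_eq_one_of_intModel_of_additive_tamLocal_forall hI' 2 3
      (by norm_num) h2 (by decide) (by decide) (E := ⟨2, 1, 5, 0, 30, 1, 64, 18, 72, 4, 4⟩) rfl
      tamLocal_check_110224g1_2 (by decide)
  · exact absurd h3 hv3
  · -- `v = 83`: additive type III, `c = 2`
    exact LocalTorsionAway.natCard_ker_nsmul_adicCompletion_eq_one_of_intModel_of_additive hI' 83 3 (by norm_num) h83
      (by decide) (by decide)
      (IntModelTam.localTamagawaNumber_padic_eq_of_intModel_of_tamLocal hI' 83 (E := ⟨83, 9, 4, 0, 55, 0, 0, 3, 3, 2, 2⟩)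
        rfl tamLocal_check_110224g1_83 (c := 2) (by decide)) (by norm_num)

/-- **`3² ∣ #Ш(110224f1)[3^∞]`** from the visible element and the Cassels–Tate parity (`hCT`). Conditional on `hMR`, `hCT`.
[cite: SilvermanAEC2009, Thm. X.4.14] [cite: MazurRubin2015SelmerCompanions, Thm. 3.1 (iv)(b)] -/
theorem sq_dvd_card_sha_three_selfTwist_v110224f1
    (hCT : exists_casselsTate_pairing (K := ℚ))
    (hMR : selmerLocalKer_iff_of_goodReduction_above)
    (hGZK : rank_eq_analyticRank_of_analyticRank_le_one)
    (W : WeierstrassCurve ℚ) [W.IsElliptic] [W.IsGloballyMinimal]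
    (hI : integralModelInt W = ⟨0, 1, 0, (-6670848), (-12548797516)⟩) (hr : W.analyticRank = 0)
    (W' : WeierstrassCurve ℚ) (hW' : W' = ⟨0, 1, 0, (-968), 21620⟩) [W'.IsElliptic]
    (θ : geomTorsion W' ((3 : ℕ) : ℤ) ≃+ geomTorsion W ((3 : ℕ) : ℤ))
    (hθ : ∀ (σ : Field.absoluteGaloisGroup ℚ) (P : geomTorsion W' ((3 : ℕ) : ℤ)), θ (σ • P) = σ • θ P)
    (hrank : 1 ≤ W'.mordellWeilRank) :
    3 ^ 2 ∣ Nat.card (AddCommGroup.primaryComponent W.sha 3) := by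
  haveI : Finite W.sha := (hGZK W (by rw [hr]; exact zero_le_one)).2
  exact Visible.sq_dvd_card_sha_three_of_exists_sha_torsion hCT W
    (exists_sha_three_selfTwist_v110224f1 hMR hGZK W hI hr W' hW' θ hθ hrank)

/-- **The typed LOWER binder `MissingLowerBoundAt E 3` for `110224f1`** (`ord₃ #Ш_an ≤ ord₃ #Ш`) from the visible
`3`-torsion element, the Cassels–Tate squareness and the analytic datum `#Ш_an = 9` (`hq`, Cremona `allbsd`;
evidence binder). Conditional on `hMR`, `hCT`. [cite: SilvermanAEC2009, Thm. X.4.14] [cite: Cremona2006, Table 1 (label 110224f1)] -/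
theorem missingLowerBoundAt_three_selfTwist_v110224f1
    (hCT : exists_casselsTate_pairing (K := ℚ))
    (hMR : selmerLocalKer_iff_of_goodReduction_above)
    (hGZK : rank_eq_analyticRank_of_analyticRank_le_one)
    (W : WeierstrassCurve ℚ) [W.IsElliptic] [W.IsGloballyMinimal]
    (hI : integralModelInt W = ⟨0, 1, 0, (-6670848), (-12548797516)⟩) (hr : W.analyticRank = 0)
    {q : ℚ} (hq : shaAn W = (q : ℂ)) (hv : padicValRat 3 q ≤ 2)
    (W' : WeierstrassCurve ℚ) (hW' : W' = ⟨0, 1, 0, (-968), 21620⟩) [W'.IsElliptic]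
    (θ : geomTorsion W' ((3 : ℕ) : ℤ) ≃+ geomTorsion W ((3 : ℕ) : ℤ))
    (hθ : ∀ (σ : Field.absoluteGaloisGroup ℚ) (P : geomTorsion W' ((3 : ℕ) : ℤ)), θ (σ • P) = σ • θ P)
    (hrank : 1 ≤ W'.mordellWeilRank) :
    haveI : Fact (Nat.Prime 3) := ⟨Nat.prime_three⟩
    MissingLowerBoundAt W 3 := by
  haveI : Fact (Nat.Prime 3) := ⟨Nat.prime_three⟩
  have hvis := exists_sha_three_selfTwist_v110224f1 hMR hGZK W hI hr W' hW' θ hθ hrank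
  exact missingLowerBoundAt_of_casselsTate_of_pow_dvd W 3 hCT (hGZK W (by rw [hr]; exact zero_le_one)).2 hq
    (k := 1) (by simpa using hv) (by simpa using dvd_shaOrder_of_exists_torsion W 3 hvis)


end Summit.BirchSwinnertonDyer.Rank1Residual.X10.SelfTwist

end
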